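import Summits.CriticalPhenomena.PercolationContinuityZ3.Theorems.PercShatteringRaceFreeSusceptibilityPowerSavingTransfer
import HarnessLib

/-!
# Crux `PercShatteringRace.FreeSusceptibilityPowerSaving` = S(1/2) (stmt-CriticalPhenomena-5786), line `bk-hyperscaling-tail-transfer` — the transfer of the RESHAPED open stub: SOME admissible member ⟹ S(1/2)

Helper file of the line lead (prover-line-stmt-CriticalPhenomena-5786-c13-0), `--supports stmt-CriticalPhenomena-5786`.
After the lead-c13 reshape of the checked skeleton `Cruxes/FreeSusceptibilityPowerSaving/Lines/bk_hyperscaling_tail_transfer.lean`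
(2026-08-17) the ONE registered open stub of the line is `stub_admissibleMember`: there exist reals `θ, e, A` with `0 < θ < 1`,
`0 ≤ e`, `11θ - 4e ≥ 1`, `A ≥ 1` such that the CENTRE-rooted in-box volume tail of bond percolation on `ℤ³` at `p_c` obeys
`P_{p_c}(n ≤ |C_R(0)|) ≤ A R^e n^{-θ}` for all `R, n ≥ 1` — i.e. SOME admissible member `W(θ, e)` of the BK-hyperscaling family
holds.  This is exactly the hypothesis of the landed general member transfer
`FreeSusceptibilityPowerSavingTransfer.sum_le_of_member` (p88151; Hutchcroft, PTRF 181 (2021) = arXiv:2008.11197, Thm 2.1/2.5 on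
the free-box weighted graph, composed from the landed halves `stub_typicalMaxBound` p85738 / `stub_rootedMeanBound` p85768 via
`hyperscalingBK` p87764), hence the weakest statement the line's kernel-checked machinery converts into the crux; the theorem
below records that transfer BY NAME, so that in the tree the crux is literally `stub_admissibleMember → FreeSusceptibilityPowerSaving`.
Every previously named antecedent is an instance: `W(1/3, 2)` (`(θ, e) = (1/3, 2/3)`, the stub registered 2026-08-16 … lead c12,
`stub_transfer` p88151), `W(1/2, 9/4)` (`e = 9/8`), `W(1/5, 3/2)` (`e = 3/10`), and the bulk `δ ≤ 11` tail (`(1/11, 0)`, in-box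
piece ⊆ bulk cluster; `TransferTG.freeSusceptibilityPowerSaving_of_bulkTailEleventh` p99752).  The members are pairwise
inequivalent on the census's shattered jump worlds (crux `NOTES.md` §L (π4): member `(θ, κθ)` holds iff `b ≥ 12/(11 - 1/θ) - 1`),
so the existential is strictly weaker than each of them and is as faithful to `S(1/2)` (`b ≥ 1/5`) as Thm 2.5's range `θ < 1`
allows (`b > 1/5`).  The antecedent is OPEN and engine-less (census `Cruxes/FreeSusceptibilityPowerSaving/STRATEGY-CENSUS.md`
v1 D1–D4 / v2 D5–D7: no at-`p_c(ℤ³)` upper bound with a power of the scale for an increasing rooted in-box quantity is known).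
No new definitions; nothing specific to `p_c` beyond the instantiation.
-/

noncomputable section

namespace Summit.CriticalPhenomena.PercolationContinuityZ3.Theorems

open MeasureTheory ProbabilityTheory Filter Finset
open Literature.Probability.Percolation Literature.Probability.LatticeModels
open scoped Classical ProbabilityTheory

/-- **stub_admissibleMemberTransfer — the reshaped line's transfer, BY NAME (registered stub of crux
stmt-CriticalPhenomena-5786, lead c13).**  If SOME admissible member of the BK-hyperscaling family holds at the centre of
the free box — reals `θ, e, A` with `0 < θ < 1`, `0 ≤ e`, `1 ≤ 11θ - 4e`, `1 ≤ A` and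
`P_{p_c}(n ≤ |C_R(0)|) ≤ A R^e n^{-θ}` for all `R, n ≥ 1` (the registered open stub `stub_admissibleMember`, spelled out
verbatim as the antecedent) — then `PercShatteringRace.FreeSusceptibilityPowerSaving` = S(1/2):
`Σ_{y ∈ Λ_R} P_{p_c}(0 ↔ y in Λ_R) ≤ C R^{5/2}` for all `R ≥ 1`.  Proof: unpack and apply the landed general member transfer
`FreeSusceptibilityPowerSavingTransfer.sum_le_of_member` (Hutchcroft's Thm 2.1/2.5 on `ℤ³[Λ_R]` + the free-box dictionary +
root-uniformity from the centre + the exchange-rate arithmetic `(2e + 3(1-θ))/(1+θ) ≤ 5/2 ⟺ 11θ - 4e ≥ 1`).  The antecedent is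
never trivial (the volume bound supplies only members with `e ≥ 3θ`, and then `11θ - 4e ≤ -θ < 1`) and is OPEN.
[cite: Hutchcroft2021, Thm 2.1 (p. 11) and Thm 2.5 (p. 14)] -/
theorem stub_admissibleMemberTransfer :
    (∃ θ e A : ℝ, 0 < θ ∧ θ < 1 ∧ 0 ≤ e ∧ 1 ≤ 11 * θ - 4 * e ∧ 1 ≤ A ∧
      ∀ R : ℕ, 1 ≤ R → ∀ n : ℕ, 1 ≤ n →
        (bondPercolation (zdGraph 3) (criticalProbI 3)).real
            {ω | n ≤ ((box 3 R).filter fun v => ω ∈ openConnIn ↑(box 3 R) 0 v).card}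
          ≤ A * (R : ℝ) ^ e * (n : ℝ) ^ (-θ)) →
    Summit.CriticalPhenomena.PercolationContinuityZ3.Theses.PercShatteringRace.FreeSusceptibilityPowerSaving := by
  rintro ⟨θ, e, A, hθ0, hθ1, he, hrate, hA, hW⟩
  exact FreeSusceptibilityPowerSavingTransfer.sum_le_of_member hθ0 hθ1 he hrate hA hW

/-- The member registered until lead c12, `W(1/3, 2)` (antecedent of `stub_transfer`, p88151), is one instance of the
reshaped stub: `(θ, e) = (1/3, 2/3)`, `11θ - 4e = 1`. [cite: Hutchcroft2021, Thm 2.1] -/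
theorem admissibleMember_of_cubeRootVolumeTail
    (hW : ∃ A : ℝ, 1 ≤ A ∧ ∀ R : ℕ, 1 ≤ R → ∀ n : ℕ, 1 ≤ n →
      (bondPercolation (zdGraph 3) (criticalProbI 3)).real
          {ω | n ≤ ((box 3 R).filter fun v => ω ∈ openConnIn ↑(box 3 R) 0 v).card}
        ≤ A * (R : ℝ) ^ ((2 : ℝ) / 3) * (n : ℝ) ^ (-(1 : ℝ) / 3)) :
    ∃ θ e A : ℝ, 0 < θ ∧ θ < 1 ∧ 0 ≤ e ∧ 1 ≤ 11 * θ - 4 * e ∧ 1 ≤ A ∧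
      ∀ R : ℕ, 1 ≤ R → ∀ n : ℕ, 1 ≤ n →
        (bondPercolation (zdGraph 3) (criticalProbI 3)).real
            {ω | n ≤ ((box 3 R).filter fun v => ω ∈ openConnIn ↑(box 3 R) 0 v).card}
          ≤ A * (R : ℝ) ^ e * (n : ℝ) ^ (-θ) := by
  obtain ⟨A, hA, h⟩ := hW
  refine ⟨1 / 3, 2 / 3, A, by norm_num, by norm_num, by norm_num, by norm_num, hA, fun R hR n hn => ?_⟩
  have h' := h R hR n hn
  rw [show (-(1 : ℝ) / 3) = -((1 : ℝ) / 3) by ring] at h'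
  convert h' using 2

/-- The bulk `δ ≤ 11` volume tail restricted to the box, `P_{p_c}(n ≤ |C_R(0)|) ≤ A n^{-1/11}` uniformly in `R`
(antecedent species of `TransferTG.freeSusceptibilityPowerSaving_of_bulkTailEleventh`, p99752, once the in-box piece is
compared with the bulk cluster), is the instance `(θ, e) = (1/11, 0)`, `11θ - 4e = 1`. [cite: Hutchcroft2021, Thm 2.1] -/
theorem admissibleMember_of_inBoxTailEleventh
    (hW : ∃ A : ℝ, 1 ≤ A ∧ ∀ R : ℕ, 1 ≤ R → ∀ n : ℕ, 1 ≤ n →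
      (bondPercolation (zdGraph 3) (criticalProbI 3)).real
          {ω | n ≤ ((box 3 R).filter fun v => ω ∈ openConnIn ↑(box 3 R) 0 v).card}
        ≤ A * (n : ℝ) ^ (-((1 : ℝ) / 11))) :
    ∃ θ e A : ℝ, 0 < θ ∧ θ < 1 ∧ 0 ≤ e ∧ 1 ≤ 11 * θ - 4 * e ∧ 1 ≤ A ∧
      ∀ R : ℕ, 1 ≤ R → ∀ n : ℕ, 1 ≤ n →
        (bondPercolation (zdGraph 3) (criticalProbI 3)).real
            {ω | n ≤ ((box 3 R).filter fun v => ω ∈ openConnIn ↑(box 3 R) 0 v).card}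
          ≤ A * (R : ℝ) ^ e * (n : ℝ) ^ (-θ) := by
  obtain ⟨A, hA, h⟩ := hW
  refine ⟨1 / 11, 0, A, by norm_num, by norm_num, le_rfl, by norm_num, hA, fun R hR n hn => ?_⟩
  have h' := h R hR n hn
  simpa [Real.rpow_zero] using h'

/-- `W(1/3, 2) ⟹ S(1/2)` re-derived through the reshaped transfer (same content as `stub_transfer`, p88151).
[cite: Hutchcroft2021, Thm 2.1] -/
theorem freeSusceptibilityPowerSaving_of_cubeRootVolumeTail
    (hW : ∃ A : ℝ, 1 ≤ A ∧ ∀ R : ℕ, 1 ≤ R → ∀ n : ℕ, 1 ≤ n →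
      (bondPercolation (zdGraph 3) (criticalProbI 3)).real
          {ω | n ≤ ((box 3 R).filter fun v => ω ∈ openConnIn ↑(box 3 R) 0 v).card}
        ≤ A * (R : ℝ) ^ ((2 : ℝ) / 3) * (n : ℝ) ^ (-(1 : ℝ) / 3)) :
    Summit.CriticalPhenomena.PercolationContinuityZ3.Theses.PercShatteringRace.FreeSusceptibilityPowerSaving :=
  stub_admissibleMemberTransfer (admissibleMember_of_cubeRootVolumeTail hW)

/-- The `R`-uniform in-box eleventh-root tail ⟹ S(1/2), through the reshaped transfer. [cite: Hutchcroft2021, Thm 2.1] -/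
theorem freeSusceptibilityPowerSaving_of_inBoxTailEleventh
    (hW : ∃ A : ℝ, 1 ≤ A ∧ ∀ R : ℕ, 1 ≤ R → ∀ n : ℕ, 1 ≤ n →
      (bondPercolation (zdGraph 3) (criticalProbI 3)).real
          {ω | n ≤ ((box 3 R).filter fun v => ω ∈ openConnIn ↑(box 3 R) 0 v).card}
        ≤ A * (n : ℝ) ^ (-((1 : ℝ) / 11))) :
    Summit.CriticalPhenomena.PercolationContinuityZ3.Theses.PercShatteringRace.FreeSusceptibilityPowerSaving :=
  stub_admissibleMemberTransfer (admissibleMember_of_inBoxTailEleventh hW)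

end Summit.CriticalPhenomena.PercolationContinuityZ3.Theorems

end
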